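import Literature.Barriers.CriticalPhenomena.LaceExpansionEtaZeroXSpaceEventually
import Literature.Barriers.CriticalPhenomena.LaceExpansionHighDimensionMeanFieldExplicit
import HarnessLib

/-!
# `η = 0` in `x`-space and Kozma–Nachmias's `ρ_ex = 1/2` with an EXPLICIT dimension threshold:
# every `d ≥ D_HS = 4 160 000·(275·5000·300·(16⁴+1)·4¹³)²` (`≈ 1.37·10⁴⁹`), in particular every `d ≥ 10⁵⁰`

Barrier catalogue `Literature/Barriers/CriticalPhenomena/` (D-0021). THEOREMS ONLY. Companion of
`LaceExpansionEtaZeroXSpaceEventually.lean` (`rhoExHalf_eventually : ∃ d₀ > 6, ∀ d ≥ d₀, RhoExHalf d`,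
threshold existential) and of `LaceExpansionHighDimensionMeanFieldExplicit.lean` (the `k`-space chain
of Heydenreich–van der Hofstad Ch. 8 with explicit constants: `f(p) ≤ 1 + c₁₀/d` below `p_c` for
`d ≥ D_HS`). Here the `x`-space chain is re-run POINTWISE in `d`, so that the threshold of the formal
proof becomes a numeral:

* `bootF_le_of_haraSladeThreshold_le` — the bootstrap output `f(p) ≤ 1 + c₁₀/d` (`p < p_c`),
  `c₁₀ = 52·4·2000·c²`, `c = 275·5000·300·(16⁴+1)·4¹³`, for `d ≥ D_HS = 4 160 000 c²` (the tactic
  body of `percInfraredBound_of_haraSladeThreshold_le`, stopped one step earlier); `bootF_le_two_…`;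
* `percTriBar_le_of_haraSladeThreshold_le` (Lemma 8.5 at `p_c` with `K = 2`: `Δ_{p_c} ≤ 1 + 320000/d`,
  `Δ̃_{p_c} ≤ 320000/d`), `kap_lt_one_of_haraSladeThreshold_le` (`2Δ̃Δ̄ < 1`),
  `tsum_tsum_piNDiagramPc_ne_top_of_haraSladeThreshold_le` (the Hara–Slade diagrams are summable);
* `exists_isLaceCoefficientPc_of_haraSladeThreshold_le` — Hara's Prop. 1.2 AT `p_c` with a finite
  second moment, for `d ≥ D_HS` (the tactic body of `exists_subcritBody_largeD` with Lemma 8.4 supplied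
  by `ExplicitThreshold.lemma84_explicit` at `K = 4`, then `exists_isLaceCoefficientPc_of_subcrit`);
* **`etaZeroXSpace_of_haraSladeThreshold_le`**, **`twoPointBoundedRatio_of_haraSladeThreshold_le`**,
  **`rhoExHalf_of_haraSladeThreshold_le`** — Hara 2008 Thm. 1.1, Aizenman's (t-c) with `η = 0`, and
  Kozma–Nachmias 2011 Thm. 1 (`c/n² ≤ P_{p_c}(0 ↔ ∂Λ_n) ≤ C/n²`) for EVERY `d ≥ D_HS`, unconditionally;
  round forms `etaZeroXSpace_of_ten_pow_fifty_le`, `rhoExHalf_of_ten_pow_fifty_le`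
  (**`10⁵⁰ ≤ d → RhoExHalf d`**).

STATUS OF THE NUMBER: as in `LaceExpansionHighDimensionMeanFieldExplicit.lean` — `D_HS` is a
property of this library's formal proof (un-optimised constants), not a printed threshold (Hara 2008:
`d ≥ 19`; Fitzner–van der Hofstad 2017: `d ≥ 11`). With it, "mean-field one-arm decay for all
`d ≥ 11`" is a FINITE statement modulo the formal proof: the dimensions `11 ≤ d < D_HS` (named facts
`Hara2008_etaZeroXSpace`, `KozmaNachmias2011_rhoExHalf`, resting on computer-assisted bounds) plus
these theorems. Honest reading: REPRODUCTION of Hara–Slade 1990, Hara 2008, Kozma–Nachmias 2011.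

## References

* T. Hara, Ann. Probab. 36 (2008) 530–593: Thm. 1.1, Prop. 1.2, Lemmas 1.5–1.7, §3.5. [Hara2008]
* T. Hara, G. Slade, Comm. Math. Phys. 128 (1990) 333–391: Thm. 1.1, p. 339. [HaraSlade1990]
* G. Kozma, A. Nachmias, J. Amer. Math. Soc. 24 (2011) 375–409: Thm. 1. [KozmaNachmias2011]
* M. Heydenreich, R. van der Hofstad, Springer 2017: Lemma 8.4, Lemma 8.5, Prop. 8.8, Cor. 8.13,
  Thm. 11.4, Thm. 11.5. [HeydenreichVanDerHofstad2017]
-/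

noncomputable section

open scoped ENNReal

namespace Literature.Barriers.CriticalPhenomena

open _root_.MeasureTheory _root_.Filter _root_.Topology Literature.Probability.LatticeModels
  Literature.Probability.Percolation ExplicitThreshold

variable {d : ℕ}

/-! ### The bootstrap output below `p_c`, explicitly -/

/-- **The bootstrap output with explicit constants**: for `d ≥ 4 160 000 c²`,
`c = 275·5000·300·(16⁴+1)·4¹³`, and every `p < p_c`, `f(p) ≤ 1 + 416 000 c²/d` — the chain
Lemma 8.4 → Prop. 8.3 → Lemmas 8.11–8.12 → Prop. 8.10 → Prop. 8.8 of
`LaceExpansionHighDimensionMeanFieldExplicit.lean` (the tactic body of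
`percInfraredBound_of_haraSladeThreshold_le`, ending one step earlier with `prop88_explicit`).
[cite: HeydenreichVanDerHofstad2017, Prop. 8.8 and Ch. 8 (Lemma 8.1, Prop. 8.3, Lemma 8.4, Prop. 8.10, Lemmas 8.11–8.12)]
[cite: HaraSlade1990, §4.1] -/
theorem bootF_le_of_haraSladeThreshold_le
    (hd : 4160000 * (275 * 5000 * (300 * (16 ^ 4 + 1)) * 4 ^ 13) ^ 2 ≤ d) (p : unitInterval)
    (hp : (p : ℝ) < criticalProb (zdGraph d) (0 : Site d)) :
    bootF d p ≤ 1 + 52 * (4 * (400 * (275 * 5000 * (300 * (16 ^ 4 + 1)) * 4 ^ 13 : ℝ) ^ 2 * (1 + 4))) / d := by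
  set c : ℝ := 275 * 5000 * (300 * (16 ^ 4 + 1)) * 4 ^ 13 with hc
  have hdR : 4160000 * c ^ 2 ≤ (d : ℝ) := by rw [hc]; exact_mod_cast hd
  have hK : (1 : ℝ) ≤ 4 := by norm_num
  have hc1 : (1 : ℝ) ≤ c := by rw [hc]; norm_num
  have hc5 : 5000 * (4 : ℝ) ^ 6 ≤ c := by rw [hc]; norm_num
  have hc6 : 2 ^ 31 * (4 : ℝ) ^ 4 ≤ c := by rw [hc]; norm_num
  have hc7 : 275 * 5000 * (300 * (16 ^ 4 + 1)) * (4 : ℝ) ^ 13 ≤ c := by rw [hc]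
  have hc2 : c ≤ c ^ 2 := by nlinarith
  have hd39 : 39 ≤ d := le_trans (by norm_num) hd
  have hd2 : 2 ≤ d := by omega
  -- the thresholds of the chain in dimension `d`, all dominated by `4 160 000 c² ≤ d`
  have t84 : 8 * c ≤ (d : ℝ) := by nlinarith
  have t83 : 2 * (400 * c ^ 2 * (1 + 4)) ≤ (d : ℝ) := by nlinarith
  have t811 : 2 * (4 * (400 * c ^ 2 * (1 + 4))) ≤ (d : ℝ) := by nlinarith
  have t812a : 300 * (4 * (400 * c ^ 2 * (1 + 4))) ≤ (d : ℝ) := by nlinarith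
  have t812b : 10 * (52 * (4 * (400 * c ^ 2 * (1 + 4)))) ≤ (d : ℝ) := by nlinarith
  have t88 : 52 * (4 * (400 * c ^ 2 * (1 + 4))) ≤ (d : ℝ) := by nlinarith
  -- the chain; each layer as a function of the dimension `d' ≥ d`
  have H84 : ∀ d' : ℕ, d ≤ d' → ∀ p : unitInterval, (p : ℝ) < criticalProb (zdGraph d') (0 : Site d') →
      bootF d' p ≤ 4 → ∀ N : ℕ,
        (Summable (lacePi d' p N) ∧
          ∑' x, lacePi d' p N x ≤ (400 * c ^ 2 * (1 + 4) / d') ^ max N 1) ∧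
        ∀ k : Fin d' → ℝ,
          Summable (fun x => (1 - Real.cos (kdot k x)) * lacePi d' p N x) ∧
          ∑' x, (1 - Real.cos (kdot k x)) * lacePi d' p N x ≤
            (1 - Dhat d' k) * (400 * c ^ 2 * (1 + 4) / d') ^ max (N - 1) 1 :=
    fun d' hd' p hp hf N =>
      lemma84_explicit hK hc1 hc5 hc6 hc7 (hd39.trans hd') (t84.trans (by exact_mod_cast hd')) p hp hf N
  have H83 := fun (d' : ℕ) (hd' : d ≤ d') (p : unitInterval)
      (hp : (p : ℝ) < criticalProb (zdGraph d') (0 : Site d')) (hf : bootF d' p ≤ 4) =>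
    prop83_explicit (c := 400 * c ^ 2 * (1 + 4)) (by positivity) H84 hd' (hd2.trans hd')
      (t83.trans (by exact_mod_cast hd')) p hp hf
  have H811 := fun (d' : ℕ) (hd' : d ≤ d') (p : unitInterval)
      (hp : (p : ℝ) < criticalProb (zdGraph d') (0 : Site d')) (hf : bootF d' p ≤ 4) =>
    lemma811_explicit (c := 4 * (400 * c ^ 2 * (1 + 4))) (by positivity) H83 hd' (hd2.trans hd')
      (t811.trans (by exact_mod_cast hd')) p hp hf
  have H812 := fun (d' : ℕ) (hd' : d ≤ d') (p : unitInterval) (_hp0 : 0 < (p : ℝ))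
      (hp : (p : ℝ) < criticalProb (zdGraph d') (0 : Site d')) (hf : bootF d' p ≤ 4) =>
    lemma812_explicit (c := 4 * (400 * c ^ 2 * (1 + 4))) (by positivity) H83 H811 hd' hd'
      (hd2.trans hd') (t812a.trans (by exact_mod_cast hd')) (t812b.trans (by exact_mod_cast hd')) p hp hf
  have H810 := fun (d' : ℕ) (hd' : d ≤ d') (p : unitInterval) (hp0 : 0 < (p : ℝ))
      (hp : (p : ℝ) < criticalProb (zdGraph d') (0 : Site d')) (hf : bootF d' p ≤ 4) =>
    prop810_explicit (c₁ := 52 * (4 * (400 * c ^ 2 * (1 + 4)))) (by positivity) H811 H812 hd' hd'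
      (le_trans (by norm_num) (hd39.trans hd')) p hp0 hp hf
  exact prop88_explicit (c := 52 * (4 * (400 * c ^ 2 * (1 + 4)))) (by positivity) H810 le_rfl hd2 t88 p hp

/-- For `d ≥ 4 160 000 c²` the bootstrap function obeys `f(p) ≤ 2` below `p_c`
(`416 000 c² ≤ d`). [cite: HeydenreichVanDerHofstad2017, Prop. 8.8] -/
theorem bootF_le_two_of_haraSladeThreshold_le
    (hd : 4160000 * (275 * 5000 * (300 * (16 ^ 4 + 1)) * 4 ^ 13) ^ 2 ≤ d) (p : unitInterval)
    (hp : (p : ℝ) < criticalProb (zdGraph d) (0 : Site d)) : bootF d p ≤ 2 := by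
  refine (bootF_le_of_haraSladeThreshold_le hd p hp).trans ?_
  set c : ℝ := 275 * 5000 * (300 * (16 ^ 4 + 1)) * 4 ^ 13 with hc
  have hdR : 4160000 * c ^ 2 ≤ (d : ℝ) := by rw [hc]; exact_mod_cast hd
  have hdpos : (0 : ℝ) < d := lt_of_lt_of_le (by rw [hc]; norm_num) hdR
  have t88 : 52 * (4 * (400 * c ^ 2 * (1 + 4))) ≤ (d : ℝ) := by nlinarith
  have : 52 * (4 * (400 * c ^ 2 * (1 + 4))) / (d : ℝ) ≤ 1 := by rwa [div_le_one hdpos]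
  linarith

/-! ### The critical diagrams for `d ≥ D_HS` -/

/-- **Lemma 8.5 at `p_c` for `d ≥ D_HS`**: `Δ_{p_c} ≤ 1 + 320000/d` and `Δ̃_{p_c} ≤ 320000/d`
(`percTriBar_le_of_bootF_le` at `K = 2`). [cite: HeydenreichVanDerHofstad2017, Lemma 8.5 and Cor. 8.13 (proof)] -/
theorem percTriBar_le_of_haraSladeThreshold_le
    (hd : 4160000 * (275 * 5000 * (300 * (16 ^ 4 + 1)) * 4 ^ 13) ^ 2 ≤ d) :
    percTriBar d ≤ ENNReal.ofReal (1 + 320000 / d) ∧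
      percTriTildeBar d ≤ ENNReal.ofReal (320000 / d) := by
  have hd38 : 38 ≤ d := le_trans (by norm_num) hd
  have h2 := percTriBar_le_of_bootF_le (K := 2) (by norm_num) hd38 (bootF_le_two_of_haraSladeThreshold_le hd)
  norm_num at h2
  exact h2

/-- **`2Δ̃_{p_c}Δ̄_{p_c} < 1` for `d ≥ D_HS`** (`≤ 2·0.32·1.32`; the pointwise form of
`two_mul_percTriTildeBar_mul_percTriBar_lt_one_of_prop88`).
[cite: HeydenreichVanDerHofstad2017, Prop. 7.4 (remark "we need that 2Δ̃_pΔ_p < 1") and Prop. 8.8] -/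
theorem kap_lt_one_of_haraSladeThreshold_le
    (hd : 4160000 * (275 * 5000 * (300 * (16 ^ 4 + 1)) * 4 ^ 13) ^ 2 ≤ d) :
    2 * percTriTildeBar d * percTriBar d < 1 := by
  have hd6 : (1000000 : ℝ) ≤ d := by exact_mod_cast le_trans (by norm_num) hd
  have hdpos : (0 : ℝ) < d := by linarith
  obtain ⟨hΔ, hΔt⟩ := percTriBar_le_of_haraSladeThreshold_le hd
  have ha : (320000 : ℝ) / d ≤ 0.32 := by
    rw [div_le_iff₀ hdpos]; linarith
  have hb : (1 : ℝ) + 320000 / d ≤ 1.32 := by linarith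
  calc 2 * percTriTildeBar d * percTriBar d
      ≤ 2 * ENNReal.ofReal 0.32 * ENNReal.ofReal 1.32 := by
        gcongr
        · exact hΔt.trans (ENNReal.ofReal_le_ofReal ha)
        · exact hΔ.trans (ENNReal.ofReal_le_ofReal hb)
    _ = ENNReal.ofReal (2 * 0.32 * 1.32) := by
        rw [ENNReal.ofReal_mul (by norm_num), ENNReal.ofReal_mul zero_le_two, ENNReal.ofReal_ofNat]
    _ < 1 := by
        rw [← ENNReal.ofReal_one]
        exact (ENNReal.ofReal_lt_ofReal_iff zero_lt_one).2 (by norm_num)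

/-- **The Hara–Slade diagrams at `p_c` are summable for `d ≥ D_HS`** (`N = 0` below `Δ_{p_c}`,
`N ≥ 1` by the geometric sum; the pointwise form of `tsum_tsum_piNDiagramPc_ne_top_of_prop88`).
[cite: HeydenreichVanDerHofstad2017, Prop. 7.4 ((7.5.3)) and Cor. 8.13 (proof)] -/
theorem tsum_tsum_piNDiagramPc_ne_top_of_haraSladeThreshold_le
    (hd : 4160000 * (275 * 5000 * (300 * (16 ^ 4 + 1)) * 4 ^ 13) ^ 2 ≤ d) :
    (∑' N : ℕ, ∑' x : Site d, piNDiagramPc d N x) ≠ ⊤ := by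
  have hΔ : percTriBar d < ⊤ :=
    lt_of_le_of_lt (percTriBar_le_of_haraSladeThreshold_le hd).1 ENNReal.ofReal_lt_top
  have hK := kap_lt_one_of_haraSladeThreshold_le hd
  rw [tsum_eq_zero_add' ENNReal.summable]
  refine (ENNReal.add_lt_top.2 ⟨?_, ?_⟩).ne
  · exact lt_of_le_of_lt FitznerVanDerHofstad2017_triangleBoundsPc.tsum_piNDiagramPc_zero_le_percTriBar hΔ
  · exact tsum_tsum_piNDiagramPc_succ_lt_top hΔ hK

/-! ### Hara's Prop. 1.2 at `p_c` for `d ≥ D_HS` -/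

/-- **Hara's Prop. 1.2 at `p = p_c` for every `d ≥ D_HS`**: a lace-expansion coefficient `Ψ` AT
`p_c` (`IsLaceCoefficientPc d Ψ`) with `Σ_x |x|²|Ψ(x)| < ∞` — the tactic body of
`exists_subcritBody_largeD` (Lemma 8.4's `[1 - cos]`-weighted bounds with `f(p) ≤ 2 ≤ 4`, the critical
diagrams, smallness `1 320 000/d + 16 000 c²/d < 1`) with Lemma 8.4 supplied by
`ExplicitThreshold.lemma84_explicit` at `K = 4` (rate `2000 c²/d ≤ 1/2`), followed by Hara's
Appendix A (`exists_isLaceCoefficientPc_of_subcrit`).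
[cite: Hara2008, Prop. 1.2 ((1.16)–(1.17)) and Appendix A (items 1–4)]
[cite: HeydenreichVanDerHofstad2017, Lemma 8.4, Lemma 8.5 and Cor. 8.13 ((8.5.1)–(8.5.2) and its proof)] -/
theorem exists_isLaceCoefficientPc_of_haraSladeThreshold_le
    (hd : 4160000 * (275 * 5000 * (300 * (16 ^ 4 + 1)) * 4 ^ 13) ^ 2 ≤ d) :
    ∃ Ψ : Site d → ℝ, IsLaceCoefficientPc d Ψ ∧ Summable fun x => euclidNorm x ^ 2 * |Ψ x| := by
  set c : ℝ := 275 * 5000 * (300 * (16 ^ 4 + 1)) * 4 ^ 13 with hc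
  have hdR : 4160000 * c ^ 2 ≤ (d : ℝ) := by rw [hc]; exact_mod_cast hd
  have hK : (1 : ℝ) ≤ 4 := by norm_num
  have hc1 : (1 : ℝ) ≤ c := by rw [hc]; norm_num
  have hc5 : 5000 * (4 : ℝ) ^ 6 ≤ c := by rw [hc]; norm_num
  have hc6 : 2 ^ 31 * (4 : ℝ) ^ 4 ≤ c := by rw [hc]; norm_num
  have hc7 : 275 * 5000 * (300 * (16 ^ 4 + 1)) * (4 : ℝ) ^ 13 ≤ c := by rw [hc]
  have hd39 : 39 ≤ d := le_trans (by norm_num) hd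
  have hd32 : 3200000 ≤ d := le_trans (by norm_num) hd
  have hd7 : 7 ≤ d := by omega
  have hd2 : 2 ≤ d := by omega
  have hdpos : (0 : ℝ) < d := by exact_mod_cast (show 0 < d by omega)
  have t84 : 8 * c ≤ (d : ℝ) := by nlinarith
  -- the critical diagrams (Lemma 8.5 at `p_c`, Prop. 7.4)
  obtain ⟨hΔ, hΔt⟩ := percTriBar_le_of_haraSladeThreshold_le hd
  have hfin := tsum_tsum_piNDiagramPc_ne_top_of_haraSladeThreshold_le hd
  have hbub : Summable fun x : Site d => tau d (criticalProbI d) 0 x ^ 2 :=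
    summable_tau_sq_of_percTriBar_lt_top (lt_of_le_of_lt hΔ ENNReal.ofReal_lt_top)
  -- `f(p) ≤ 4` below `p_c`
  have hf4 : ∀ p : unitInterval, (p : ℝ) < criticalProb (zdGraph d) (0 : Site d) → bootF d p ≤ 4 :=
    fun p hp => (bootF_le_two_of_haraSladeThreshold_le hd p hp).trans (by norm_num)
  -- Lemma 8.4 at `K = 4`, rate `r = 2000c²/d`
  set r : ℝ := 400 * c ^ 2 * (1 + 4) / d with hr
  have hr0 : 0 ≤ r := by positivity
  have hr12 : r ≤ 1 / 2 := by rw [hr, div_le_iff₀ hdpos]; nlinarith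
  have H84 : ∀ p : unitInterval, (p : ℝ) < criticalProb (zdGraph d) (0 : Site d) →
      bootF d p ≤ 4 → ∀ N : ℕ,
        (Summable (lacePi d p N) ∧ ∑' x, lacePi d p N x ≤ r ^ max N 1) ∧
        ∀ k : Fin d → ℝ,
          Summable (fun x => (1 - Real.cos (kdot k x)) * lacePi d p N x) ∧
          ∑' x, (1 - Real.cos (kdot k x)) * lacePi d p N x ≤ (1 - Dhat d k) * r ^ max (N - 1) 1 :=
    fun p hp hf N => lemma84_explicit hK hc1 hc5 hc6 hc7 hd39 t84 p hp hf N
  -- `(r)^{(N-1)∨1} ≤ 4 r 2^{-N}` (`pow_max_sub_one_le`), of sum `8 r`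
  have hbS : Summable fun N : ℕ => 4 * r * (1 / 2 : ℝ) ^ N := summable_geom_aux r 4
  have hbsum : ∑' N : ℕ, 4 * r * (1 / 2 : ℝ) ^ N = 8 * r := by rw [tsum_geom_aux]; ring
  -- a point `0 < p₀ < p_c`
  obtain ⟨p₀, hp₀0, hp₀c⟩ := exists_lt_lt_criticalProbI (criticalProbI_pos' (d := d) (by omega))
  have hp₀ : p₀ < criticalProbI d := by
    rw [← Subtype.coe_lt_coe, coe_criticalProbI]; exact hp₀c
  have hp₀0' : 0 < (p₀ : ℝ) := by
    have h := Subtype.coe_lt_coe.2 hp₀0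
    simpa using h
  have H : ∃ (b : ℕ → ℝ) (p₀ : unitInterval), Summable b ∧ p₀ < criticalProbI d ∧ 0 < (p₀ : ℝ) ∧
      (∑' q, Function.uncurry (subcritMajorant d) q) + (∑' N, b N) < 1 ∧
      ∀ p : unitInterval, p < criticalProbI d → ∀ N, ∀ k ∈ cube d,
        (Summable fun x => (1 - Real.cos (kdot k x)) * lacePi d p N x) ∧
          ∑' x, (1 - Real.cos (kdot k x)) * lacePi d p N x ≤ b N * (1 - Dhat d k) := by
    refine ⟨fun N => 4 * r * (1 / 2) ^ N, p₀, hbS, hp₀, hp₀0', ?_, fun p hp N k hk => ?_⟩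
    · -- smallness: `Σ_NΣ_x h^{(N)} + Σ_N b_N ≤ 1320000/d + 8 r < 1`
      have hA := tsum_uncurry_subcritMajorant_le hd32 hΔ hΔt hfin hbub
      have h8 : 8 * r ≤ 1 / 2 := by
        rw [hr, show (8 : ℝ) * (400 * c ^ 2 * (1 + 4) / d) = 8 * (400 * c ^ 2 * (1 + 4)) / d by ring,
          div_le_iff₀ hdpos]; nlinarith
      have h5 : (1320000 : ℝ) / d ≤ 1320000 / 3200000 :=
        div_le_div_of_nonneg_left (by norm_num) (by norm_num) (by exact_mod_cast hd32)
      rw [hbsum]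
      linarith
    · -- the `[1 - cos]`-weighted bounds (8.3.6) with `f(p) ≤ 4`
      have hp' : (p : ℝ) < criticalProb (zdGraph d) (0 : Site d) := hp
      obtain ⟨-, hk84⟩ := H84 p hp' (hf4 p hp') N
      obtain ⟨hs, hle⟩ := hk84 k
      refine ⟨hs, hle.trans ?_⟩
      rw [mul_comm]
      exact mul_le_mul_of_nonneg_right (pow_max_sub_one_le hr0 hr12 N) (one_sub_Dhat_nonneg k)
  obtain ⟨Φ, h', c₁, C, p₁, hh, hc₁, hp₁, hP, hIR⟩ := subcritBody_of_weightedBounds hd2 hfin hbub H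
  exact exists_isLaceCoefficientPc_of_subcrit hd7 hh hc₁ hp₁ hP hIR

/-! ### The assemblies with the explicit threshold -/

/-- **Hara 2008, Thm. 1.1 for every `d ≥ D_HS = 4 160 000·(275·5000·300·(16⁴+1)·4¹³)²`, UNCONDITIONAL**:
`EtaZeroXSpace d`, i.e. `τ_{p_c}(x) = A₂|x|^{2-d}(1 + O(|x|^{-2/d}))` — `etaZeroXSpace_at_of_inputs`
with Prop. 1.2 at `p_c` (`exists_isLaceCoefficientPc_of_haraSladeThreshold_le`), Lemma 1.5
(`lemma15At_of_twoLongLinesAt` ∘ `twoLongLines_real`, with `S̄_{p_c} < ∞` by Lemma 1.7) and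
`2Δ̃Δ̄ < 1`, all at this `d`.
[cite: Hara2008, Thm. 1.1, §1.2, Lemma 1.5 and §3.5] [cite: HeydenreichVanDerHofstad2017, Thm. 11.4 (11.2.3)]
[cite: HaraSlade1990, Thm. 1.1 and p. 339] -/
theorem etaZeroXSpace_of_haraSladeThreshold_le
    (hd : 4160000 * (275 * 5000 * (300 * (16 ^ 4 + 1)) * 4 ^ 13) ^ 2 ≤ d) : EtaZeroXSpace d := by
  have hd11 : 11 ≤ d := le_trans (by norm_num) hd
  have hK : 2 * percTriTildeBar d * percTriBar d < 1 := kap_lt_one_of_haraSladeThreshold_le hd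
  have hfin := tsum_tsum_piNDiagramPc_ne_top_of_haraSladeThreshold_le hd
  obtain ⟨Φ, hΦ, hsum⟩ := exists_isLaceCoefficientPc_of_haraSladeThreshold_le hd
  have hκ : kap d < 1 := hK
  exact etaZeroXSpace_at_of_inputs hd11 ⟨Φ, hΦ, hsum⟩
    (lemma15At_of_twoLongLinesAt hd11 hfin
      (twoLongLines_real (by omega) (percSqBar_lt_top_of_coefficient hd11 hΦ hsum) hκ)) hK

/-- **Aizenman's (t-c) with `η = 0` for every `d ≥ D_HS`, UNCONDITIONAL**: `TwoPointBoundedRatio d`.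
[cite: HeydenreichVanDerHofstad2017, (1.2.3)–(1.2.4) and (1.2.14)] [cite: Aizenman1997, §5 (condition (t-c) with η = 0)] -/
theorem twoPointBoundedRatio_of_haraSladeThreshold_le
    (hd : 4160000 * (275 * 5000 * (300 * (16 ^ 4 + 1)) * 4 ^ 13) ^ 2 ≤ d) : TwoPointBoundedRatio d :=
  (etaZeroXSpace_of_haraSladeThreshold_le hd).twoPointBoundedRatio (le_trans (by norm_num) hd)
    fun x => tau_criticalProbI_pos (le_trans (by norm_num) hd) 0 x

/-- **Kozma–Nachmias 2011, Thm. 1 for every `d ≥ D_HS = 4 160 000·(275·5000·300·(16⁴+1)·4¹³)²`,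
UNCONDITIONAL in the kernel**: `RhoExHalf d`, i.e. `c/n² ≤ P_{p_c}(0 ↔ ∂Λ_n) ≤ C/n²` for all `n ≥ 1`
(`TwoPointBoundedRatio.rhoExHalf`, the whole of Kozma–Nachmias's paper proved in the catalogue, applied to
`twoPointBoundedRatio_of_haraSladeThreshold_le`).
[cite: KozmaNachmias2011, Thm. 1] [cite: HeydenreichVanDerHofstad2017, Thm. 11.5 (11.3.2)] [cite: Hara2008, Thm. 1.1] -/
theorem rhoExHalf_of_haraSladeThreshold_le
    (hd : 4160000 * (275 * 5000 * (300 * (16 ^ 4 + 1)) * 4 ^ 13) ^ 2 ≤ d) : RhoExHalf d :=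
  (twoPointBoundedRatio_of_haraSladeThreshold_le hd).rhoExHalf (lt_of_lt_of_le (by norm_num) hd)

/-- **Hara 2008, Thm. 1.1 for every `d ≥ 10⁵⁰`** (round form; `10⁵⁰ ≥ D_HS`). UNCONDITIONAL.
[cite: Hara2008, Thm. 1.1] [cite: HeydenreichVanDerHofstad2017, Thm. 11.4 (11.2.3)] -/
theorem etaZeroXSpace_of_ten_pow_fifty_le (hd : 10 ^ 50 ≤ d) : EtaZeroXSpace d :=
  etaZeroXSpace_of_haraSladeThreshold_le (le_trans (by norm_num) hd)

/-- **Kozma–Nachmias 2011, Thm. 1 for every `d ≥ 10⁵⁰`: `c/n² ≤ P_{p_c(ℤ^d)}(0 ↔ ∂Λ_n) ≤ C/n²`**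
(round form; `10⁵⁰ ≥ D_HS`). UNCONDITIONAL, standard axioms, no named fact.
[cite: KozmaNachmias2011, Thm. 1] [cite: HeydenreichVanDerHofstad2017, Thm. 11.5 (11.3.2)] -/
theorem rhoExHalf_of_ten_pow_fifty_le (hd : 10 ^ 50 ≤ d) : RhoExHalf d :=
  rhoExHalf_of_haraSladeThreshold_le (le_trans (by norm_num) hd)

end Literature.Barriers.CriticalPhenomena

end
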